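import Summits.ValiantsHypothesis.ValiantsHypothesis.Theorems.KPlusLogSqLawTridiagonalRealStatic

/-!
# Route «KPlusLogSqLaw», crux `WeakLifting` (stmt-ValiantsHypothesis-19561) — REAL side of the tridiagonal sector:
# a STATIC DEFINITE symmetric tridiagonal `7 × 7` monomial matrix with EIGHT positive determinant zeros («Z ≤ m» is false)

HONEST FRAMING.  Helper theorems (`--supports stmt-ValiantsHypothesis-19561 --as helper`) about the REAL side of the witness-plan stub
`stub_tridiagonalSectorB` (`Cruxes/WeakLifting/Lines/birth.lean`), in the typed currency of the desk's α target of record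
`staticTridiagonal_definite_posRoots_le` (lead R2102, amended R2114: a real symmetric TRIDIAGONAL matrix of MONOMIALS
`c i j · X ^ (e i j)` with POSITIVE DIAGONAL COEFFICIENTS has at most `B m` distinct positive determinant zeros, `B` explicit and linear).
Seat val-sym-lift-p1 (g11), cell `pub-symmetroid`, 2026-08-27.  One explicit matrix and its exact root certificate; NOTHING here is an
upper bound; nothing bears on `WeakLifting` / `TropicalB` (stmt-19771) in their windows, on Conjecture B, on the Door-A registers, on
`MatrixDescartes` (stmt-ValiantsHypothesis-18050) or on VP ≠ VNP.  FIXED-FORMAT statement (target repair / calibration).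

CONTEXT.  The kernel holds `B m ≥ m` for `m = 5, …, 10` (`…TridiagonalRealStaticFive`, `…StaticTridiagonalDefiniteSix/SevenEight/NineTen`,
`…TridiagonalRealStatic` §Ten, `…TridiagonalRealStaticChain67/89`) and the cell's located conjecture of record read «B m = m (m ≥ 5)»
(never more than `m` zeros found).  THIS FILE REFUTES «Z ≤ m»: a size-`7` instance with `8` distinct positive zeros.

THE WITNESS.  Path on `7` vertices; diagonal entries `(X, 4, X, 1, 1, 2, 2)`, off-diagonal entries `(2, X, 2X, X⁵, 8X⁶, 64X⁴⁰)` (integer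
coefficients, natural exponents, one monomial per entry, nothing off the band).  Its edge weights
`W_k = c_(k,k+1)² x^(2e_(k,k+1)) / (c_kk c_(k+1,k+1) x^(e_kk + e_(k+1,k+1)))` are `(x⁻¹, x/4, 4x, x¹⁰ | 32x¹², 1024x⁸⁰)`: the `m = 5`
block of `…TridiagonalRealStaticFive` (five zeros on four edges) followed by TWO hierarchical fast edges that switch on INSIDE the block's
own transition window (`W₅ = 1` at `t = ln x ≈ −0.29`, `W₆ = 1` at `t ≈ −0.087`).  MECHANISM (located, seat memo / tools `detector2.py`):
appending increasing fast edges to a slow cluster with pivot `R = p₄/p₃` realises a «rotating detector» that alternately collects zeros of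
`p₄` and of `p₃` between consecutive switches and gains one zero at every switch where `sign R = (−1)^(i+1)`; for this cluster the schedule
«switch in `(−1.36, −0.08)`, switch again in `(−0.08, 0)`» is worth `c + 2 = 6`, two more than the number of slow edges, so the
six-edge design carries `6 + 2 = 8` zeros.

WHAT IS PROVED.  Through the continuant normal form (`StaticTridiagonalReal.det_ctPath`, lift-p3 g8),
`det F(x) = −16x + 80x² − 68x³ + 16x¹¹ − 16x¹² + 516x¹³ − 2560x¹⁴ + 2176x¹⁵ + 16384x⁸¹ − 81920x⁸² + 69632x⁸³ − 16384x⁹¹ + 16384x⁹² − 4096x⁹³`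
(`eval_det_seven`), which alternates in sign `−,+,−,+,−,+,−,+,−` at `x = 1/4, 1/2, 7/8, 15/16, 31/32, 1, 3/2, 2, 3` (`eight_le_card_posRoots_seven`);
hence `≥ 8` distinct positive zeros (intermediate values; exact Sturm count offline: exactly `8`; Descartes allows `12`).  Corollaries in the
typed currency: `exists_static_definite_tridiagonal_seven_eight` and `not_posRoots_le_size_static_tridiagonal_seven` (it is FALSE that every
static definite symmetric tridiagonal `7 × 7` monomial matrix has at most `7` distinct positive determinant zeros).  So any linear law for the
sub-sector has `B 7 ≥ 8`; the slope of `B` is NOT located to be `1`.  [data of this seat] explicit matrix; [folklore] continuants / IVT.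
-/

-- `Summit.ValiantsHypothesis.ValiantsHypothesis.…` repeats a component by the D-0017 layout (single-conjunct summit); the name is mandated.
set_option linter.dupNamespace false

namespace Summit.ValiantsHypothesis.ValiantsHypothesis.Theorems.KPlusLogSqLaw.StaticTridiagonalRealExcess

open scoped BigOperators Matrix
open Polynomial
open Summit.ValiantsHypothesis.ValiantsHypothesis.Theorems.ValuativeFlip (ctK ctPath ctPath_apply ctK_zero ctK_one ctK_add_two)
open Summit.ValiantsHypothesis.ValiantsHypothesis.Theorems.KPlusLogSqLaw.StaticTridiagonalReal (det_ctPath)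
open Summit.ValiantsHypothesis.ValiantsHypothesis.Theorems.SymmetroidDescartes (le_card_posRoots_of_alternating)

/-- Closed form of the determinant of the `7 × 7` witness (a STATIC DEFINITE symmetric tridiagonal matrix of monomials, written as the
path matrix of its diagonal `(X, 4, X, 1, 1, 2, 2)` and its off-diagonal `(2, X, 2X, X⁵, 8X⁶, 64X⁴⁰)`), through the continuant normal form
`det_ctPath`. [data of this seat] -/
theorem eval_det_seven (t : ℝ) :
    ((ctPath
      (fun t : ℕ => if t = 0 then (X : ℝ[X]) else if t = 1 then (C (4 : ℝ) : ℝ[X]) else if t = 2 then (X : ℝ[X]) else if t = 3 then (1 : ℝ[X]) else if t = 4 then (1 : ℝ[X]) else if t = 5 then (C (2 : ℝ) : ℝ[X]) else if t = 6 then (C (2 : ℝ) : ℝ[X]) else (0 : ℝ[X]))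
      (fun t : ℕ => if t = 0 then (C (2 : ℝ) : ℝ[X]) else if t = 1 then (X : ℝ[X]) else if t = 2 then (C (2 : ℝ) * X : ℝ[X]) else if t = 3 then (X ^ 5 : ℝ[X]) else if t = 4 then (C (8 : ℝ) * X ^ 6 : ℝ[X]) else if t = 5 then (C (64 : ℝ) * X ^ 40 : ℝ[X]) else (0 : ℝ[X]))
      (fun t : ℕ => if t = 0 then (0 : ℝ[X]) else if t = 1 then (C (2 : ℝ) : ℝ[X]) else if t = 2 then (X : ℝ[X]) else if t = 3 then (C (2 : ℝ) * X : ℝ[X]) else if t = 4 then (X ^ 5 : ℝ[X]) else if t = 5 then (C (8 : ℝ) * X ^ 6 : ℝ[X]) else if t = 6 then (C (64 : ℝ) * X ^ 40 : ℝ[X]) else (0 : ℝ[X])) 7).det).eval t =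
      (-4096 : ℝ) * t ^ 93 +
      (16384 : ℝ) * t ^ 92 +
      (-16384 : ℝ) * t ^ 91 +
      (69632 : ℝ) * t ^ 83 +
      (-81920 : ℝ) * t ^ 82 +
      (16384 : ℝ) * t ^ 81 +
      (2176 : ℝ) * t ^ 15 +
      (-2560 : ℝ) * t ^ 14 +
      (516 : ℝ) * t ^ 13 +
      (-16 : ℝ) * t ^ 12 +
      (16 : ℝ) * t ^ 11 +
      (-68 : ℝ) * t ^ 3 +
      (80 : ℝ) * t ^ 2 +
      (-16 : ℝ) * t ^ 1 := by
  rw [det_ctPath]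
  simp only [ctK_add_two, ctK_one, ctK_zero]
  norm_num [eval_add, eval_sub, eval_mul, eval_neg, eval_pow, eval_C, eval_X]
  ring

/-- **At least eight distinct positive zeros on six edges (size seven)**: the determinant of the `7 × 7` witness alternates in sign
(`−,+,−,+,−,+,−,+,−`) at `x = 1/4, 1/2, 7/8, 15/16, 31/32, 1, 3/2, 2, 3`. [data of this seat] -/
theorem eight_le_card_posRoots_seven :
    8 ≤ (((ctPath
      (fun t : ℕ => if t = 0 then (X : ℝ[X]) else if t = 1 then (C (4 : ℝ) : ℝ[X]) else if t = 2 then (X : ℝ[X]) else if t = 3 then (1 : ℝ[X]) else if t = 4 then (1 : ℝ[X]) else if t = 5 then (C (2 : ℝ) : ℝ[X]) else if t = 6 then (C (2 : ℝ) : ℝ[X]) else (0 : ℝ[X]))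
      (fun t : ℕ => if t = 0 then (C (2 : ℝ) : ℝ[X]) else if t = 1 then (X : ℝ[X]) else if t = 2 then (C (2 : ℝ) * X : ℝ[X]) else if t = 3 then (X ^ 5 : ℝ[X]) else if t = 4 then (C (8 : ℝ) * X ^ 6 : ℝ[X]) else if t = 5 then (C (64 : ℝ) * X ^ 40 : ℝ[X]) else (0 : ℝ[X]))
      (fun t : ℕ => if t = 0 then (0 : ℝ[X]) else if t = 1 then (C (2 : ℝ) : ℝ[X]) else if t = 2 then (X : ℝ[X]) else if t = 3 then (C (2 : ℝ) * X : ℝ[X]) else if t = 4 then (X ^ 5 : ℝ[X]) else if t = 5 then (C (8 : ℝ) * X ^ 6 : ℝ[X]) else if t = 6 then (C (64 : ℝ) * X ^ 40 : ℝ[X]) else (0 : ℝ[X])) 7).det).roots.toFinset.filter (fun t => 0 < t)).card := by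
  refine le_card_posRoots_of_alternating _ 8
    (![1/4, 1/2, 7/8, 15/16, 31/32, 1, 3/2, 2, 3] : Fin 9 → ℝ) ?_ ?_ ?_
  · refine Fin.strictMono_iff_lt_succ.2 fun j => ?_
    fin_cases j <;> simp only [Fin.castSucc_mk, Fin.succ_mk] <;> norm_num
  · intro j; fin_cases j <;> norm_num
  · intro j; fin_cases j <;> simp only [eval_det_seven, Fin.castSucc_mk, Fin.succ_mk] <;> norm_num

/-- The `7 × 7` witness in the desk's typed currency (R2102/R2114): with the natural-number coefficient table `c` and exponent table `e`
below (read off the three diagonals), the monomial matrix `of (fun i j => C (c i j) * X ^ (e i j))` IS the path matrix of `eval_det_seven`.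
[data of this seat] -/
theorem of_eq_ctPath_seven :
    (Matrix.of fun i j : Fin 7 =>
        C ((((fun i j : Fin 7 => (if (j : ℕ) = i then (fun t : ℕ => if t = 0 then 1 else if t = 1 then 4 else if t = 2 then 1 else if t = 3 then 1 else if t = 4 then 1 else if t = 5 then 2 else if t = 6 then 2 else 0) i else if (j : ℕ) = i + 1 then (fun t : ℕ => if t = 0 then 2 else if t = 1 then 1 else if t = 2 then 2 else if t = 3 then 1 else if t = 4 then 8 else if t = 5 then 64 else 0) i else if (i : ℕ) = j + 1 then (fun t : ℕ => if t = 0 then 2 else if t = 1 then 1 else if t = 2 then 2 else if t = 3 then 1 else if t = 4 then 8 else if t = 5 then 64 else 0) j else 0 : ℕ)) i j : ℕ) : ℝ)) * (X : ℝ[X]) ^ ((fun i j : Fin 7 => (if (j : ℕ) = i then (fun t : ℕ => if t = 0 then 1 else if t = 1 then 0 else if t = 2 then 1 else if t = 3 then 0 else if t = 4 then 0 else if t = 5 then 0 else if t = 6 then 0 else 0) i else if (j : ℕ) = i + 1 then (fun t : ℕ => if t = 0 then 0 else if t = 1 then 1 else if t = 2 then 1 else if t = 3 then 5 else if t = 4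 then 6 else if t = 5 then 40 else 0) i else if (i : ℕ) = j + 1 then (fun t : ℕ => if t = 0 then 0 else if t = 1 then 1 else if t = 2 then 1 else if t = 3 then 5 else if t = 4 then 6 else if t = 5 then 40 else 0) j else 0 : ℕ)) i j)) =
      (ctPath
      (fun t : ℕ => if t = 0 then (X : ℝ[X]) else if t = 1 then (C (4 : ℝ) : ℝ[X]) else if t = 2 then (X : ℝ[X]) else if t = 3 then (1 : ℝ[X]) else if t = 4 then (1 : ℝ[X]) else if t = 5 then (C (2 : ℝ) : ℝ[X]) else if t = 6 then (C (2 : ℝ) : ℝ[X]) else (0 : ℝ[X]))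
      (fun t : ℕ => if t = 0 then (C (2 : ℝ) : ℝ[X]) else if t = 1 then (X : ℝ[X]) else if t = 2 then (C (2 : ℝ) * X : ℝ[X]) else if t = 3 then (X ^ 5 : ℝ[X]) else if t = 4 then (C (8 : ℝ) * X ^ 6 : ℝ[X]) else if t = 5 then (C (64 : ℝ) * X ^ 40 : ℝ[X]) else (0 : ℝ[X]))
      (fun t : ℕ => if t = 0 then (0 : ℝ[X]) else if t = 1 then (C (2 : ℝ) : ℝ[X]) else if t = 2 then (X : ℝ[X]) else if t = 3 then (C (2 : ℝ) * X : ℝ[X]) else if t = 4 then (X ^ 5 : ℝ[X]) else if t = 5 then (C (8 : ℝ) * X ^ 6 : ℝ[X]) else if t = 6 then (C (64 : ℝ) * X ^ 40 : ℝ[X]) else (0 : ℝ[X])) 7) := by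
  ext i j
  simp only [Matrix.of_apply, ctPath_apply]
  have hi : (i : ℕ) < 7 := i.isLt
  have hj : (j : ℕ) < 7 := j.isLt
  by_cases h1 : (j : ℕ) = i
  · simp only [h1, if_true]
    generalize (i : ℕ) = t at hi ⊢
    interval_cases t <;> simp
  · rw [if_neg h1, if_neg h1, if_neg h1]
    by_cases h2 : (j : ℕ) = i + 1
    · simp only [h2, if_true]
      have hi' : (i : ℕ) < 6 := by omega
      generalize (i : ℕ) = t at hi' ⊢
      interval_cases t <;> simp
    · rw [if_neg h2, if_neg h2, if_neg h2]
      by_cases h3 : (i : ℕ) = j + 1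
      · simp only [h3, if_true]
        have hj' : (j : ℕ) < 6 := by omega
        generalize (j : ℕ) = t at hj' ⊢
        interval_cases t <;> simp
      · rw [if_neg h3, if_neg h3, if_neg h3]
        simp

/-- **A STATIC DEFINITE SYMMETRIC TRIDIAGONAL `7 × 7` MONOMIAL MATRIX WITH EIGHT POSITIVE DETERMINANT ZEROS** — one MORE than its size —
in the typed currency of the desk's α target `staticTridiagonal_definite_posRoots_le` (R2102/R2114: `c`, `e` symmetric, `c = 0` off the
band, `0 < c i i`): any linear law `B` for the sub-sector has `B 7 ≥ 8`. [data of this seat] -/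
theorem exists_static_definite_tridiagonal_seven_eight :
    ∃ (c : Fin 7 → Fin 7 → ℝ) (e : Fin 7 → Fin 7 → ℕ),
      (∀ i j, c i j = c j i) ∧ (∀ i j, e i j = e j i) ∧
      (∀ i j : Fin 7, (i : ℕ) + 1 < j ∨ (j : ℕ) + 1 < i → c i j = 0) ∧ (∀ i, 0 < c i i) ∧
      8 ≤ ((Matrix.det (Matrix.of fun i j => C (c i j) * (X : ℝ[X]) ^ (e i j))).roots.toFinset.filter
        (fun t => 0 < t)).card := by
  refine ⟨fun i j => ((((fun i j : Fin 7 => (if (j : ℕ) = i then (fun t : ℕ => if t = 0 then 1 else if t = 1 then 4 else if t = 2 then 1 else if t = 3 then 1 else if t = 4 then 1 else if t = 5 then 2 else if t = 6 then 2 else 0) i else if (j : ℕ) = i + 1 then (fun t : ℕ => if t = 0 then 2 else if t = 1 then 1 else if t = 2 then 2 else if t = 3 then 1 else if t = 4 then 8 else if t = 5 then 64 else 0) i else if (i : ℕ) = j + 1 then (fun t : ℕ => if t = 0 then 2 else if t = 1 then 1 else if t = 2 then 2 else if t = 3 then 1 else if t = 4 then 8 else if t = 5 then 64 else 0) j else 0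 : ℕ)) i j : ℕ) : ℝ)), (fun i j : Fin 7 => (if (j : ℕ) = i then (fun t : ℕ => if t = 0 then 1 else if t = 1 then 0 else if t = 2 then 1 else if t = 3 then 0 else if t = 4 then 0 else if t = 5 then 0 else if t = 6 then 0 else 0) i else if (j : ℕ) = i + 1 then (fun t : ℕ => if t = 0 then 0 else if t = 1 then 1 else if t = 2 then 1 else if t = 3 then 5 else if t = 4 then 6 else if t = 5 then 40 else 0) i else if (i : ℕ) = j + 1 then (fun t : ℕ => if t = 0 then 0 else if t = 1 then 1 else if t = 2 then 1 else if t = 3 then 5 else if t = 4 then 6 else if t = 5 then 40 else 0) j else 0 : ℕ)), ?_, ?_, ?_, ?_, ?_⟩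
  · have h : ∀ i j : Fin 7, (fun i j : Fin 7 => (if (j : ℕ) = i then (fun t : ℕ => if t = 0 then 1 else if t = 1 then 4 else if t = 2 then 1 else if t = 3 then 1 else if t = 4 then 1 else if t = 5 then 2 else if t = 6 then 2 else 0) i else if (j : ℕ) = i + 1 then (fun t : ℕ => if t = 0 then 2 else if t = 1 then 1 else if t = 2 then 2 else if t = 3 then 1 else if t = 4 then 8 else if t = 5 then 64 else 0) i else if (i : ℕ) = j + 1 then (fun t : ℕ => if t = 0 then 2 else if t = 1 then 1 else if t = 2 then 2 else if t = 3 then 1 else if t = 4 then 8 else if t = 5 then 64 else 0) j else 0 : ℕ)) i j = (fun i j : Fin 7 => (if (j : ℕ) = i then (fun t : ℕ => if t = 0 then 1 else if t = 1 then 4 else if t = 2 then 1 else if t = 3 then 1 else if t = 4 then 1 else if t = 5 then 2 else if t = 6 then 2 else 0) i else if (j : ℕ) = i + 1 then (fun t : ℕ => if t = 0 then 2 else if t = 1 then 1 else if t = 2 then 2 else if t = 3 then 1 else if t = 4 then 8 else if t = 5 then 64 else 0) i else if (i : ℕ) = j + 1 then (fun t : ℕ => if t = 0 then 2 else if t = 1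 then 1 else if t = 2 then 2 else if t = 3 then 1 else if t = 4 then 8 else if t = 5 then 64 else 0) j else 0 : ℕ)) j i := by decide
    intro i j
    exact congrArg (Nat.cast (R := ℝ)) (h i j)
  · decide
  · have h : ∀ i j : Fin 7, (i : ℕ) + 1 < j ∨ (j : ℕ) + 1 < i → (fun i j : Fin 7 => (if (j : ℕ) = i then (fun t : ℕ => if t = 0 then 1 else if t = 1 then 4 else if t = 2 then 1 else if t = 3 then 1 else if t = 4 then 1 else if t = 5 then 2 else if t = 6 then 2 else 0) i else if (j : ℕ) = i + 1 then (fun t : ℕ => if t = 0 then 2 else if t = 1 then 1 else if t = 2 then 2 else if t = 3 then 1 else if t = 4 then 8 else if t = 5 then 64 else 0) i else if (i : ℕ) = j + 1 then (fun t : ℕ => if t = 0 then 2 else if t = 1 then 1 else if t = 2 then 2 else if t = 3 then 1 else if t = 4 then 8 else if t = 5 then 64 else 0) j else 0 : ℕ)) i j = 0 := by decide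
    intro i j hij
    have h' := h i j hij
    beta_reduce at h' ⊢
    rw [h', Nat.cast_zero]
  · have h : ∀ i : Fin 7, 0 < (fun i j : Fin 7 => (if (j : ℕ) = i then (fun t : ℕ => if t = 0 then 1 else if t = 1 then 4 else if t = 2 then 1 else if t = 3 then 1 else if t = 4 then 1 else if t = 5 then 2 else if t = 6 then 2 else 0) i else if (j : ℕ) = i + 1 then (fun t : ℕ => if t = 0 then 2 else if t = 1 then 1 else if t = 2 then 2 else if t = 3 then 1 else if t = 4 then 8 else if t = 5 then 64 else 0) i else if (i : ℕ) = j + 1 then (fun t : ℕ => if t = 0 then 2 else if t = 1 then 1 else if t = 2 then 2 else if t = 3 then 1 else if t = 4 then 8 else if t = 5 then 64 else 0) j else 0 : ℕ)) i i := by decide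
    intro i
    have h' := h i
    beta_reduce at h' ⊢
    exact_mod_cast h'
  · rw [of_eq_ctPath_seven]
    exact eight_le_card_posRoots_seven

/-- **«Z ≤ m» IS NOT A LAW**: it is false that every STATIC DEFINITE symmetric tridiagonal `7 × 7` monomial matrix (coefficients `c`,
exponents `e` symmetric, `c = 0` off the band, positive diagonal coefficients) has at most `7` distinct positive determinant zeros — the cell's
located conjecture «B m = m» fails at `m = 7`. [corollary] -/
theorem not_posRoots_le_size_static_tridiagonal_seven :
    ¬ (∀ (c : Fin 7 → Fin 7 → ℝ) (e : Fin 7 → Fin 7 → ℕ), (∀ i j, c i j = c j i) → (∀ i j, e i j = e j i) →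
        (∀ i j : Fin 7, (i : ℕ) + 1 < j ∨ (j : ℕ) + 1 < i → c i j = 0) → (∀ i, 0 < c i i) →
        ((Matrix.det (Matrix.of fun i j => C (c i j) * (X : ℝ[X]) ^ (e i j))).roots.toFinset.filter
          (fun t => 0 < t)).card ≤ 7) := by
  intro h
  obtain ⟨c, e, hc, he, htri, hpos, h8⟩ := exists_static_definite_tridiagonal_seven_eight
  have := h c e hc he htri hpos
  omega

end Summit.ValiantsHypothesis.ValiantsHypothesis.Theorems.KPlusLogSqLaw.StaticTridiagonalRealExcess
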